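import Summits.CriticalPhenomena.CardyFormulaZ2.Theorems.CardyComplexConeParafermionToSLESixFamiliesDefs

/-!
# Congruence of the medial exploration in the discrete data (glue for line `caratheodory-net-slit-uniformity`)

Crux `Summit.CriticalPhenomena.CardyFormulaZ2.Theses.CardyComplexCone.ParafermionToSLESixFamilies`
(stmt-CriticalPhenomena-11389), line `caratheodory-net-slit-uniformity`, registered glue of stub
`stub_carrierEquicontinuity` (its `θ = 0` core).

`medialExploration E ω` depends on the discrete Dobrushin datum `E : DiscreteDobrushin` only through the
discrete domain graph `discreteDomainGraph E.Ω E.δ` (inner faces, medial steps, the completed configuration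
`E.bcBondConfig ω`, the `A`–`B` edges `E.zdABEdges`) and the two discrete arcs `E.zdArcA`, `E.zdArcB`
(boundary condition and start clause): this is read off the definition of `IsMedialExploration`
(`MedialInterface.lean`). Hence two data with the same carrier, the same mesh and the same discrete arcs
have the same exploration (`medialExploration_congr_arcs`), the same start angle and the same (anchored)
observable, conditional amplitudes included (`obs_congr_arcs`, `startAngle_congr_arcs`, `aobs_congr_arcs`,
`condObs_congr_arcs`). No admissibility is needed: the junk branch `[]` of `medialExploration` is congruent
too.

References: S. Smirnov, *Critical percolation in the plane*, C. R. Acad. Sci. Paris 333 (2001), §2 (the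
exploration process is determined by the discrete domain and its boundary conditions).
-/

noncomputable section

open scoped Topology NNReal ENNReal BoundedContinuousFunction
open Filter Set MeasureTheory
open Literature.Probability Literature.Probability.LatticeModels Literature.Probability.Percolation
open Literature.Probability.RandomPlanarGeometry

namespace Summit.CriticalPhenomena.CardyFormulaZ2.Cruxes.ParafermionToSLESixFamilies.CaratheodoryNetSlitUniformity

/-- Transport of `IsMedialExploration` along equal discrete domain graphs and equal discrete arcs (one
direction; the fields of `IsMedialExploration` mention `E` only through `discreteDomainGraph E.Ω E.δ`,
`E.zdArcA`, `E.zdArcB`). -/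
theorem isMedialExploration_of_graph_arcs {E E' : DiscreteDobrushin}
    (hG : discreteDomainGraph E.Ω E.δ = discreteDomainGraph E'.Ω E'.δ)
    (hA : E.zdArcA = E'.zdArcA) (hB : E.zdArcB = E'.zdArcB)
    {ω : BondConfig (Site 2)} {γ : List MedialVertex} (h : IsMedialExploration E ω γ) :
    IsMedialExploration E' ω γ := by
  have hInner : ∀ f, E.IsInnerFace f → E'.IsInnerFace f := fun f hf v w hv hw hadj => by
    rw [← hG]; exact hf v w hv hw hadj
  have hStep : ∀ e e', E.IsMedialStep e e' → E'.IsMedialStep e e' := fun e e' ⟨v, f, hc, hf, hs, ht⟩ =>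
    ⟨v, f, hc, hInner f hf, hs, ht⟩
  have hbc : E.bcBondConfig ω = E'.bcBondConfig ω := by
    ext e; simp only [DiscreteDobrushin.mem_bcBondConfig_iff, hG, hA, hB]
  have hAB : E.zdABEdges = E'.zdABEdges := by
    ext e; simp only [DiscreteDobrushin.mem_zdABEdges_iff, hG, hA, hB]
  exact
    { ne_nil := h.ne_nil
      step := fun e e' hi => hStep e e' (h.step e e' hi)
      turn := fun e₀ e₁ e₂ hi => hbc ▸ h.turn e₀ e₁ e₂ hi
      nodup := h.nodup
      head_mem := hAB ▸ h.head_mem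
      getLast_mem := hAB ▸ h.getLast_mem
      head_ne_getLast := h.head_ne_getLast
      start := fun e e' hp => by
        obtain ⟨v, f, hc, hs, ht, hv⟩ := h.start e e' hp
        exact ⟨v, f, hc, hs, ht, hA ▸ hv⟩ }

/-- `IsMedialExploration` is invariant under passing to a datum with the same discrete domain graph and
the same discrete arcs. -/
theorem isMedialExploration_iff_of_graph_arcs {E E' : DiscreteDobrushin}
    (hG : discreteDomainGraph E.Ω E.δ = discreteDomainGraph E'.Ω E'.δ)
    (hA : E.zdArcA = E'.zdArcA) (hB : E.zdArcB = E'.zdArcB)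
    (ω : BondConfig (Site 2)) (γ : List MedialVertex) :
    IsMedialExploration E ω γ ↔ IsMedialExploration E' ω γ :=
  ⟨isMedialExploration_of_graph_arcs hG hA hB,
    isMedialExploration_of_graph_arcs hG.symm hA.symm hB.symm⟩

/-- The medial exploration depends on the datum only through the discrete domain graph and the discrete
arcs (the `dite`/`choose` in `medialExploration` is applied to equal predicates). -/
theorem medialExploration_congr_graph_arcs {E E' : DiscreteDobrushin}
    (hG : discreteDomainGraph E.Ω E.δ = discreteDomainGraph E'.Ω E'.δ)
    (hA : E.zdArcA = E'.zdArcA) (hB : E.zdArcB = E'.zdArcB) :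
    medialExploration E = medialExploration E' := by
  classical
  funext ω
  have hpred : IsMedialExploration E ω = IsMedialExploration E' ω :=
    funext fun γ => propext (isMedialExploration_iff_of_graph_arcs hG hA hB ω γ)
  unfold medialExploration
  exact congrArg (fun P : List MedialVertex → Prop =>
    if h : ∃! γ : List MedialVertex, P γ then h.exists.choose else ([] : List MedialVertex)) hpred

/-- **Registered glue `medialExploration_congr_arcs`.** Two discrete Dobrushin data with the same carrier,
the same mesh and the same discrete wired / dual-wired arcs have the same medial exploration, for every
configuration (admissible or not). -/
theorem medialExploration_congr_arcs : ∀ (E E' : DiscreteDobrushin), E.Ω = E'.Ω → E.δ = E'.δ →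
    E.zdArcA = E'.zdArcA → E.zdArcB = E'.zdArcB → medialExploration E = medialExploration E' := by
  intro E E' hΩ hδ hA hB
  exact medialExploration_congr_graph_arcs (by rw [hΩ, hδ]) hA hB

/-- Same carrier, mesh and discrete arcs: same observable `obs`. -/
theorem obs_congr_arcs {E E' : DiscreteDobrushin} (hΩ : E.Ω = E'.Ω) (hδ : E.δ = E'.δ)
    (hA : E.zdArcA = E'.zdArcA) (hB : E.zdArcB = E'.zdArcB) : obs E = obs E' := by
  funext z
  simp only [obs, medialExploration_congr_arcs E E' hΩ hδ hA hB, hδ]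

/-- Same carrier, mesh and discrete arcs: same start angle. -/
theorem startAngle_congr_arcs {E E' : DiscreteDobrushin} (hΩ : E.Ω = E'.Ω) (hδ : E.δ = E'.δ)
    (hA : E.zdArcA = E'.zdArcA) (hB : E.zdArcB = E'.zdArcB) : startAngle E = startAngle E' := by
  simp only [startAngle, medialExploration_congr_arcs E E' hΩ hδ hA hB, hδ]

/-- **Registered glue `aobs_congr_arcs`.** Same carrier, mesh and discrete arcs: same absolutely anchored
observable (the `θ = 0` core of `CarrierEquicontinuity`, with `ρ = 1`). -/
theorem aobs_congr_arcs : ∀ (E E' : DiscreteDobrushin), E.Ω = E'.Ω → E.δ = E'.δ →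
    E.zdArcA = E'.zdArcA → E.zdArcB = E'.zdArcB → aobs E = aobs E' := by
  intro E E' hΩ hδ hA hB
  funext z
  simp only [aobs, obs_congr_arcs hΩ hδ hA hB, startAngle_congr_arcs hΩ hδ hA hB]

/-- Same carrier, mesh and discrete arcs: same conditional inner amplitudes. -/
theorem condObs_congr_arcs {E E' : DiscreteDobrushin} (hΩ : E.Ω = E'.Ω) (hδ : E.δ = E'.δ)
    (hA : E.zdArcA = E'.zdArcA) (hB : E.zdArcB = E'.zdArcB) : condObs E = condObs E' := by
  funext Q ξ z
  simp only [condObs, medialExploration_congr_arcs E E' hΩ hδ hA hB, hδ]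

end Summit.CriticalPhenomena.CardyFormulaZ2.Cruxes.ParafermionToSLESixFamilies.CaratheodoryNetSlitUniformity

end
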